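import Literature.Probability.LatticeModels.LocalPerturbationPolymerGas
import HarnessLib

/-!
# Local perturbations of a finite-range dependent reference process: positivity for real data

`Literature/Probability/LatticeModels/`; continues `LocalPerturbationPolymerGas` (setting and
notation there: cells `p : V` with adjacency `R`, local σ-algebras `𝓕 p`, cell factors `g p` with
`‖g p‖ ≤ ε`, `IsLocalPerturbation`; `pertZ μ g C = ∫ ∏_{p ∈ C} (1 + g p) dμ`,
`cellActivity μ g K = ∫ ∏_{p ∈ K} g p dμ`).

**Positivity by continuity** (`pertZ_re_pos_of_im_cellActivity_eq_zero`, the mechanism by which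
reflection-type symmetries of the perturbation yield `Z > 0` without any positivity of the
individual weights; cf. the tree's `re_polymerPartitionFunction_pos_of_kp` for abstract polymer
gases under the Kotecký–Preiss condition): if the activities `M(K)`, `K ⊆ C`, are real and
Dobrushin's smallness condition `e ε (Δ + 1)² ≤ 1/2` holds, then `Z(C)` is real and `> 0`.
Indeed along the ray `t ↦ t • g`, `t ∈ [0, 1]`, the partition function `Σ_{K ⊆ C} t^{#K} M(K)`
(`cellActivity_smul`) is a real polynomial, zero-free by `pertZ_ne_zero` (the hypotheses are
stable under `|t| ≤ 1`, `IsLocalPerturbation.smul`), and equal to `1` at `t = 0`; by the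
intermediate value theorem it is positive at `t = 1`.

The general form `pertZ_re_pos_of_im_pertZ_smul_eq_zero` only asks the partition function to be
real along the ray; `im_pertZ_smul_eq_zero_of_involution` supplies this from an involution of the
cell sets conjugating the activities, and `pertZ_re_pos_of_reflection` from a REFLECTION of the data
(a `μ`-preserving `Θ : Ω → Ω` and an injective involution `σ` of the cells with
`g (σ p) ∘ Θ = conj (g p)`; `cellActivity_image_eq_conj`) — the time-reflection Hermiticity of
actions of Hamiltonian origin. Everything is proved.

## References

* S. Friedli, Y. Velenik, *Statistical Mechanics of Lattice Systems*, CUP (2017), §5.7.1.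
  [FriedliVelenik2017]
* R. L. Dobrushin, *Estimates of semi-invariants for the Ising model at low temperatures*, AMS
  Transl. (2) 177 (1996) 59–81. [Dobrushin1996]
-/

noncomputable section

open _root_.MeasureTheory _root_.ProbabilityTheory Finset
open scoped BigOperators

namespace Literature.Probability.LatticeModels

variable {V : Type*} {Ω : Type*} {mΩ : MeasurableSpace Ω}

/-! ### Real data: positivity by continuity -/

section Real

variable [DecidableEq V] {μ : Measure Ω} {R : V → V → Prop} [DecidableRel R] {𝓕 : V → MeasurableSpace Ω}
  {g : V → Ω → ℂ} {ε : ℝ} {nbr : V → Finset V} {Δ : ℕ}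

/-- **Positivity for real data.** If the activities `M(K)`, `K ⊆ C`, are real and
`e ε (Δ + 1)² ≤ 1/2`, then `Z(C)` is real and positive: along `t ↦ t • g`, `t ∈ [0, 1]`, the
partition function `Σ_K t^{#K} M(K)` is real, continuous, zero-free (`pertZ_ne_zero`) and equal to
`1` at `t = 0` (intermediate value theorem).
[cite: FriedliVelenik2017, §5.7.1; Dobrushin1996] -/
theorem pertZ_re_pos_of_im_cellActivity_eq_zero [IsProbabilityMeasure μ]
    (hR : ∀ x y, R x y → R y x) (hΔ : ∀ x, (nbr x).card ≤ Δ) (hnbr : ∀ x y, R x y → y ∈ nbr x)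
    (h : IsLocalPerturbation μ R 𝓕 g ε) (hsmall : Real.exp 1 * ε * ((Δ : ℝ) + 1) ^ 2 ≤ 1 / 2)
    {C : Finset V} (hreal : ∀ K, K ⊆ C → (cellActivity μ g K).im = 0) :
    0 < (pertZ μ g C).re ∧ (pertZ μ g C).im = 0 := by
  -- the partition function along the ray, as a real polynomial in `t`
  set f : ℝ → ℝ := fun t => ∑ K ∈ C.powerset, t ^ K.card * (cellActivity μ g K).re with hf
  have hZt : ∀ t : ℝ, pertZ μ (fun p ω => (t : ℂ) * g p ω) C = (f t : ℂ) := by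
    intro t
    have ht : IsLocalPerturbation μ R 𝓕 (fun p ω => (t : ℂ) * g p ω) (max ε (|t| * ε)) := by
      refine ⟨h.le, h.indep, fun p => (h.measurable p).const_mul (t : ℂ), fun p ω => ?_,
        le_max_of_le_left h.nonneg⟩
      rw [norm_mul, Complex.norm_real, Real.norm_eq_abs]
      exact (mul_le_mul_of_nonneg_left (h.norm_le p ω) (abs_nonneg t)).trans (le_max_right _ _)
    rw [pertZ_eq_sum_cellActivity ht C, hf]
    push_cast
    refine sum_congr rfl fun K hK => ?_
    rw [cellActivity_smul]
    congr 1
    conv_lhs => rw [← Complex.re_add_im (cellActivity μ g K), hreal K (mem_powerset.1 hK)]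
    simp
  have hfc : Continuous f := by
    exact continuous_finsetSum _ fun K _ => (continuous_pow _).mul continuous_const
  have hf0 : f 0 = 1 := by
    have := hZt 0
    have h0 : pertZ μ (fun p ω => ((0 : ℝ) : ℂ) * g p ω) C = 1 := by simp [pertZ]
    rw [h0] at this
    exact_mod_cast this.symm
  have hf1 : (pertZ μ g C) = (f 1 : ℂ) := by
    rw [← hZt 1]; simp
  -- zero-freeness along the ray for `t ∈ [0, 1]`
  have hne : ∀ t ∈ Set.Icc (0 : ℝ) 1, f t ≠ 0 := by
    intro t ht hft
    have hpert := pertZ_ne_zero hR hΔ hnbr (h.smul (t := t) (by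
      rw [abs_of_nonneg ht.1]; exact ht.2)) hsmall C
    rw [hZt t, hft] at hpert
    exact hpert (by simp)
  -- intermediate value theorem
  have hpos : 0 < f 1 := by
    by_contra hle
    push Not at hle
    have hivt : ∃ t ∈ Set.Icc (0 : ℝ) 1, f t = 0 := by
      have hsub : Set.Icc (f 1) (f 0) ⊆ f '' Set.Icc (0 : ℝ) 1 :=
        intermediate_value_Icc' zero_le_one hfc.continuousOn
      have h0mem : (0 : ℝ) ∈ Set.Icc (f 1) (f 0) := ⟨hle, by rw [hf0]; exact zero_le_one⟩
      obtain ⟨t, ht, hft⟩ := hsub h0mem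
      exact ⟨t, ht, hft⟩
    obtain ⟨t, ht, hft⟩ := hivt
    exact hne t ht hft
  refine ⟨?_, ?_⟩
  · rw [hf1]; exact_mod_cast hpos
  · rw [hf1]; exact Complex.ofReal_im _

end Real

/-! ### Symmetric data: the partition function is real along the whole ray -/

section Symmetric

variable [DecidableEq V] {μ : Measure Ω} {R : V → V → Prop} [DecidableRel R]
  {𝓕 : V → MeasurableSpace Ω} {g : V → Ω → ℂ} {ε : ℝ} {nbr : V → Finset V} {Δ : ℕ}

omit [DecidableEq V] [DecidableRel R] in
/-- Scaling the cell factors by any real `t` keeps them local and bounded (by `max ε (|t| ε)`).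
[folklore] -/
theorem IsLocalPerturbation.smul' (h : IsLocalPerturbation μ R 𝓕 g ε) (t : ℝ) :
    IsLocalPerturbation μ R 𝓕 (fun p ω => (t : ℂ) * g p ω) (max ε (|t| * ε)) := by
  refine ⟨h.le, h.indep, fun p => (h.measurable p).const_mul (t : ℂ), fun p ω => ?_,
    le_max_of_le_left h.nonneg⟩
  rw [norm_mul, Complex.norm_real, Real.norm_eq_abs]
  exact (mul_le_mul_of_nonneg_left (h.norm_le p ω) (abs_nonneg t)).trans (le_max_right _ _)

omit [DecidableEq V] [DecidableRel R] in
/-- **The partition function along the ray is a polynomial**: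
`Z_{t g}(C) = Σ_{K ⊆ C} t^{#K} M_g(K)`. [cite: FriedliVelenik2017, §5.7.1] -/
theorem pertZ_smul_eq_sum [IsFiniteMeasure μ] (h : IsLocalPerturbation μ R 𝓕 g ε) (t : ℝ)
    (C : Finset V) :
    pertZ μ (fun p ω => (t : ℂ) * g p ω) C =
      ∑ K ∈ C.powerset, (t : ℂ) ^ K.card * cellActivity μ g K := by
  rw [pertZ_eq_sum_cellActivity (h.smul' t) C]
  exact sum_congr rfl fun K _ => cellActivity_smul g t K

omit [DecidableEq V] in
/-- At `t = 1` the ray is the original perturbation. [folklore] -/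
theorem pertZ_one_smul (μ : Measure Ω) (g : V → Ω → ℂ) (C : Finset V) :
    pertZ μ (fun p ω => ((1 : ℝ) : ℂ) * g p ω) C = pertZ μ g C := by
  simp [pertZ]

/-- **Positivity by continuity, general form.** If `e ε (Δ+1)² ≤ 1/2` and the partition function
is real along the ray `t ↦ t • g`, `t ∈ [0, 1]`, then `Z(C)` is real and positive.
[cite: FriedliVelenik2017, §5.7.1; Dobrushin1996] -/
theorem pertZ_re_pos_of_im_pertZ_smul_eq_zero [IsProbabilityMeasure μ]
    (hR : ∀ x y, R x y → R y x) (hΔ : ∀ x, (nbr x).card ≤ Δ) (hnbr : ∀ x y, R x y → y ∈ nbr x)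
    (h : IsLocalPerturbation μ R 𝓕 g ε) (hsmall : Real.exp 1 * ε * ((Δ : ℝ) + 1) ^ 2 ≤ 1 / 2)
    {C : Finset V}
    (hreal : ∀ t ∈ Set.Icc (0 : ℝ) 1, (pertZ μ (fun p ω => (t : ℂ) * g p ω) C).im = 0) :
    0 < (pertZ μ g C).re ∧ (pertZ μ g C).im = 0 := by
  set Z : ℝ → ℂ := fun t => pertZ μ (fun p ω => (t : ℂ) * g p ω) C with hZ
  set f : ℝ → ℝ := fun t => (Z t).re with hf
  have hZc : Continuous Z := by
    have : Z = fun t : ℝ => ∑ K ∈ C.powerset, (t : ℂ) ^ K.card * cellActivity μ g K := by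
      funext t; exact pertZ_smul_eq_sum h t C
    rw [this]
    exact continuous_finsetSum _ fun K _ =>
      ((Complex.continuous_ofReal.pow _)).mul continuous_const
  have hfc : Continuous f := Complex.continuous_re.comp hZc
  have hf0 : f 0 = 1 := by
    have h0 : Z 0 = 1 := by simp [hZ, pertZ]
    simp [hf, h0]
  have hne : ∀ t ∈ Set.Icc (0 : ℝ) 1, f t ≠ 0 := by
    intro t ht hft
    have hpert := pertZ_ne_zero hR hΔ hnbr (h.smul (t := t) (by
      rw [abs_of_nonneg ht.1]; exact ht.2)) hsmall C
    apply hpert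
    apply Complex.ext
    · simpa [hf, hZ] using hft
    · simpa using hreal t ht
  have hpos : 0 < f 1 := by
    by_contra hle
    push Not at hle
    have hsub : Set.Icc (f 1) (f 0) ⊆ f '' Set.Icc (0 : ℝ) 1 :=
      intermediate_value_Icc' zero_le_one hfc.continuousOn
    obtain ⟨t, ht, hft⟩ := hsub ⟨hle, by rw [hf0]; exact zero_le_one⟩
    exact hne t ht hft
  have h1 : pertZ μ g C = Z 1 := (pertZ_one_smul μ g C).symm
  refine ⟨?_, ?_⟩
  · rw [h1]; exact hpos
  · rw [h1]; exact hreal 1 ⟨zero_le_one, le_rfl⟩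

omit [DecidableEq V] [DecidableRel R] in
/-- **An involution on cell sets conjugating the activities makes the ray real**: if
`θ` maps subsets of `C` to subsets of `C`, is an involution there, preserves cardinality and
`M(θ K) = conj M(K)`, then `Z_{t g}(C)` is real for every real `t`. [folklore] -/
theorem im_pertZ_smul_eq_zero_of_involution [IsFiniteMeasure μ] (h : IsLocalPerturbation μ R 𝓕 g ε)
    {C : Finset V} (θ : Finset V → Finset V) (hθC : ∀ K, K ⊆ C → θ K ⊆ C)
    (hθθ : ∀ K, K ⊆ C → θ (θ K) = K) (hcard : ∀ K, K ⊆ C → (θ K).card = K.card)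
    (hconj : ∀ K, K ⊆ C → cellActivity μ g (θ K) = (starRingEnd ℂ) (cellActivity μ g K))
    (t : ℝ) : (pertZ μ (fun p ω => (t : ℂ) * g p ω) C).im = 0 := by
  rw [pertZ_smul_eq_sum h t C, ← Complex.conj_eq_iff_im, map_sum]
  -- reindex the conjugated sum by the involution
  refine Finset.sum_nbij' θ θ (fun K hK => mem_powerset.2 (hθC K (mem_powerset.1 hK)))
    (fun K hK => mem_powerset.2 (hθC K (mem_powerset.1 hK)))
    (fun K hK => hθθ K (mem_powerset.1 hK)) (fun K hK => hθθ K (mem_powerset.1 hK))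
    fun K hK => ?_
  have hKC := mem_powerset.1 hK
  rw [map_mul, map_pow, Complex.conj_ofReal, hcard K hKC, hconj K hKC]

omit [DecidableRel R] in
/-- **Activities of reflected cell sets.** If `Θ : Ω → Ω` preserves `μ` and `σ : V → V` is
injective with `g (σ p) (Θ ω) = conj (g p ω)` (a "reflection" of the data), then
`M(σ K) = conj M(K)` for every `K`. [folklore] -/
theorem cellActivity_image_eq_conj (h : IsLocalPerturbation μ R 𝓕 g ε) {Θ : Ω → Ω}
    (hΘ : MeasurePreserving Θ μ μ) {σ : V → V} (hσ : Function.Injective σ)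
    (hgσ : ∀ p ω, g (σ p) (Θ ω) = (starRingEnd ℂ) (g p ω)) (K : Finset V) :
    cellActivity μ g (K.image σ) = (starRingEnd ℂ) (cellActivity μ g K) := by
  unfold cellActivity
  rw [← integral_conj]
  have h1 : ∀ ω, (starRingEnd ℂ) (∏ p ∈ K, g p ω) = ∏ p ∈ K, g (σ p) (Θ ω) := fun ω => by
    rw [map_prod]; exact prod_congr rfl fun p _ => (hgσ p ω).symm
  have h2 : ∀ ω, ∏ p ∈ K.image σ, g p ω = ∏ p ∈ K, g (σ p) ω := fun ω =>
    prod_image fun a _ b _ hab => hσ hab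
  simp_rw [h1, h2]
  have hm : AEStronglyMeasurable (fun ω => ∏ p ∈ K, g (σ p) ω) (Measure.map Θ μ) := by
    rw [hΘ.map_eq]
    exact (Finset.measurable_prod K fun p _ => h.measurable' (σ p)).aestronglyMeasurable
  rw [← integral_map hΘ.measurable.aemeasurable hm, hΘ.map_eq]

/-- **Positivity for reflection-symmetric data.** If `e ε (Δ+1)² ≤ 1/2`, `Θ` preserves `μ`,
`σ` is an injective involution of the cells of `C` (`C.image σ = C`, `σ (σ p) = p` on `C`) and
`g (σ p) ∘ Θ = conj (g p)`, then `Z(C)` is real and positive — without any positivity of the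
individual weights. [cite: FriedliVelenik2017, §5.7.1; Dobrushin1996] -/
theorem pertZ_re_pos_of_reflection [IsProbabilityMeasure μ]
    (hR : ∀ x y, R x y → R y x) (hΔ : ∀ x, (nbr x).card ≤ Δ) (hnbr : ∀ x y, R x y → y ∈ nbr x)
    (h : IsLocalPerturbation μ R 𝓕 g ε) (hsmall : Real.exp 1 * ε * ((Δ : ℝ) + 1) ^ 2 ≤ 1 / 2)
    {C : Finset V} {Θ : Ω → Ω} (hΘ : MeasurePreserving Θ μ μ) {σ : V → V}
    (hσ : Function.Injective σ) (hσC : C.image σ = C) (hσσ : ∀ p ∈ C, σ (σ p) = p)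
    (hgσ : ∀ p ω, g (σ p) (Θ ω) = (starRingEnd ℂ) (g p ω)) :
    0 < (pertZ μ g C).re ∧ (pertZ μ g C).im = 0 := by
  refine pertZ_re_pos_of_im_pertZ_smul_eq_zero hR hΔ hnbr h hsmall fun t _ => ?_
  refine im_pertZ_smul_eq_zero_of_involution h (fun K => K.image σ) (fun K hK => ?_)
    (fun K hK => ?_) (fun K hK => ?_) (fun K hK => ?_) t
  · rw [← hσC]; exact image_subset_image hK
  · rw [image_image]
    calc K.image (σ ∘ σ) = K.image id := image_congr fun p hp => by
          simpa using hσσ p (hK hp)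
      _ = K := image_id
  · exact card_image_of_injective K hσ
  · exact cellActivity_image_eq_conj h hΘ hσ hgσ K

end Symmetric

end Literature.Probability.LatticeModels
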